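import Summits.QuantumFields.YangMills.Theorems.BalabanUVNodesC44CjOfRecordTangent
import Literature.MathematicalPhysics.QuantumFieldTheory.Balaban1983to89.B15AveragingHolomorphicLocal
import HarnessLib

/-!
# [B11] (44) AT THE RECORD — LOCALITY OF THE CONSTRAINT REMAINDERS: `C_j^{𝔰𝔩}(A′)(c)` (and `C^{𝔰𝔩} = C_k^{𝔰𝔩}`) READS `A′` ONLY ON THE BONDS OF A BLOCK-SATURATED REGION
# CONTAINING `c`, AND THE DERIVATIVE KERNEL `(D C^{𝔰𝔩}(A′)·δ_b X)(c)` VANISHES OFF THAT REGION ([B7] p.24 «Ū^k_c depends only on the bond variables U_b for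
# b ⊂ B^k(c₋) ∪ B^k(c₊)»; the SUPPORT half of the one-bond coarse-column letter (KL-C) of ✓`…Prop4ColumnsAtRecord`)

Cell `pub-ymgap` ∕ `ym-nodeO-ideate`, porter lineage `ymgap-nodeO-port-PTB-1` (gen 8); PORT-PLAN-v6 §F9 (serves ★★★ №578 (2)(ii) — the general-Ω edition of (ℓa-C) = «locality
+ F4′∕F5 at k := j» — and (2)(iii) — (ℓd)'s (KL-C)).  `--kind proof --supports stmt-QuantumFields-27238 --as helper`; count-neutral.
[B11] = [Balaban1985Variational]; [B7] = [Balaban1985Averaging]; [RG1] = [Balaban1987RG1].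

WHAT THIS FILE PROVES (0 def; `Y ⊂ T_η` a fine region SATURATED below the level — the displayed `hY` of lit ✓`B15AveragingHolomorphicLocal`, true for unions of blocks ∕ cubes
by ✓`Node00.toFine_mem_iff_of_isBlockUnion_pow/level` — and `c ∈ bondsIn j Y`):
§1 `iterMh_expOver_apply_congr` — the holomorphic `j`-fold average of the chart field `e^{iX}U₀` at `c` reads `X` only on `bondsIn 0 Y` (lit ✓`iterMh_apply_congr_of_eqOn_bondsIn`);
   `logOver_iterMh_expOver_apply_congr` (the log-coordinate (20)).
§2 `fderiv_iterMh_apply_congr_of_eqOn` — under the (0.4) guard below `j`, the holomorphic derivative `D(Ū^j_h)(↑U₀)[Z](c)` reads `Z` only on `bondsIn 0 Y` (line derivatives +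
   §1's locality at `↑U₀ + tZ`); ★ `qCplxOp_apply_congr_of_eqOn` — print's linearised average `Q_j(U₀)Y (c)` reads a TRACELESS `Y` only on `bondsIn 0 Y` (✓F1
   `fderiv_iterMh_mul_star_eq_qCplxOp`).
§3 ★★ `equiv_CslJOfRecord_apply_congr` ∕ `equiv_CslOfRecord_apply_congr` — `C_j^{𝔰𝔩}(A′)(c)` (every `j`; `C^{𝔰𝔩}` at `j = k`) depends on `A′` only through `ev(P A′)` on `bondsIn 0 Y`.
§4 ★★ `equiv_fderiv_CslJOfRecord_single_eq_zero` ∕ `equiv_fderiv_CslOfRecord_single_eq_zero` — THE SUPPORT OF THE DERIVATIVE KERNEL: for a lit bond `b` whose record bond is NOT in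
   `bondsIn 0 Y`, `(D C_j^{𝔰𝔩}(A′)·δ_b X)(c) = 0` at EVERY `A′` (differentiable or not) — so the one-bond coarse-column letter `gC(c, b)` of (KL-C) may be taken `0` off the
   two-block cone of `c`; what remains of (KL-C) is the ON-CONE entry bound `C₃η^d‖A′‖‖X‖` = [B7] Prop. 5 (157).

HONEST FRAMING.  Lattice∕calculus bookkeeping over landed locality (lit B15) and F1; NO estimate; nothing of [B11] (44)'s constant, Prop. 4, or [B7] Prop. 5 is proved here.  (ℓa-C)
discharged only for Ω_j = T; (ℓa-H), (KL-H), (KL-N), (KL-C) DISPLAYED; (R1)∕(R2) OPEN; K0ᴬ ⟨stmt-QuantumFields-27238⟩ NOT closed; K0ᴬ∕K1ᴬ∕K3ᴬ 0∕3; NODE O 0∕1; COUNT 8∕28 ·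
K 1∕4 UNMOVED; finite `𝕋⁴_{L^K}` at fixed ε — NOT continuum ∕ ℝ⁴ ∕ OS; **the Yang–Mills mass gap (Clay) is NOT proved by any of this.**  No `sorry`, `instance`, `notation`,
`set_option`; standard axioms.
-/

noncomputable section

open scoped Matrix Matrix.Norms.L2Operator InnerProductSpace ComplexConjugate Topology

namespace Summit.QuantumFields.YangMills.Theorems.C44IterMh

open Literature.MathematicalPhysics.QuantumFieldTheory.Balaban1983to89
open Literature.MathematicalPhysics.QuantumFieldTheory.Balaban1983to89.Node00
open T4Continuum BlockAveraging
open B15AveragingHolomorphic (iterMh coeField_iter_eq_iterMh differentiableAt_iterMh)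
open B15AveragingHolomorphicLocal (iterMh_apply_congr_of_eqOn_bondsIn)
open B10Eq42TorusConstraint (bondsIn mem_bondsIn_iff)
open B10Eq38TorusDomains (toFine)
open B11Eq115Space (NegSup NegSize levWeight JetSup)
open B11Eq90Transpose (single115)
open B11Eq111FrakG (nabla115)
open MatrixLog (mlog)
open ExpMeanLog (expMeanLogSU)

/-! ## §1  The holomorphic average of the chart field reads the chart only on the region -/

section Generic

variable {P : Params} {N : ℕ} [NeZero N]

omit [NeZero N] in
/-- **`Ū^j_h(e^{iX}U₀)(c)` READS `X` ONLY ON `bondsIn 0 Y`** (`Y` saturated below `j`, `c ∈ bondsIn j Y`): the chart (19) is bondwise, and the holomorphic iterate is local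
(lit ✓`iterMh_apply_congr_of_eqOn_bondsIn`). [cite: Balaban1985Averaging, p.24 («depends only on the bond variables U_b for b ⊂ B^k(c₋) ∪ B^k(c₊)»); Balaban1987RG1, (0.4) p.253] -/
theorem iterMh_expOver_apply_congr (U₀ : GaugeField P 0 (SU N)) {j : ℕ} (hj : j ≤ P.m + P.K) {Y : Set (Site P 0)}
    (hY : ∀ i, i < j → ∀ s : Site P i, toFine i s ∈ Y ↔ toFine (i + 1) (blockOf s) ∈ Y)
    {X X' : PBond P 0 → Matrix (Fin N) (Fin N) ℂ} (hXX' : ∀ b : PBond P 0, b ∈ bondsIn 0 Y → X b = X' b)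
    {c : PBond P j} (hc : c ∈ bondsIn j Y) : iterMh j (expOver U₀ X) c = iterMh j (expOver U₀ X') c :=
  iterMh_apply_congr_of_eqOn_bondsIn j hj hY (fun b hb => by rw [expOver_apply, expOver_apply, hXX' b hb]) c hc

omit [NeZero N] in
/-- The same for the log-coordinate (20): `(1∕i)·log(Ū^j_h(e^{iX}U₀)(c)·W(c)⋆)` reads `X` only on `bondsIn 0 Y`. [cite: Balaban1985Variational, (20) p.281; Balaban1985Averaging, p.24] -/
theorem logOver_iterMh_expOver_apply_congr (U₀ : GaugeField P 0 (SU N)) {j : ℕ} (hj : j ≤ P.m + P.K) {Y : Set (Site P 0)}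
    (hY : ∀ i, i < j → ∀ s : Site P i, toFine i s ∈ Y ↔ toFine (i + 1) (blockOf s) ∈ Y) (W : PBond P j → Matrix (Fin N) (Fin N) ℂ)
    {X X' : PBond P 0 → Matrix (Fin N) (Fin N) ℂ} (hXX' : ∀ b : PBond P 0, b ∈ bondsIn 0 Y → X b = X' b)
    {c : PBond P j} (hc : c ∈ bondsIn j Y) : logOver W (iterMh j (expOver U₀ X)) c = logOver W (iterMh j (expOver U₀ X')) c := by
  rw [logOver_apply, logOver_apply, iterMh_expOver_apply_congr U₀ hj hY hXX' hc]

/-! ## §2  The holomorphic derivative and print's `Q_j(U₀)` read a direction only on the region -/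

/-- **THE HOLOMORPHIC DERIVATIVE `D(Ū^j_h)(↑U₀)[Z](c)` READS `Z` ONLY ON `bondsIn 0 Y`** (guard below `j`, `Y` saturated below `j`, `c ∈ bondsIn j Y`): it is the line derivative
`d∕dt|₀ Ū^j_h(↑U₀ + tZ)(c)` (ℂ-differentiability at `↑U₀`, lit ✓`differentiableAt_iterMh`), and `↑U₀ + tZ`, `↑U₀ + tZ′` agree on `bondsIn 0 Y`.
[cite: Balaban1985Averaging, p.24, (137) p.39; Balaban1987RG1, (0.4) p.253] -/
theorem fderiv_iterMh_apply_congr_of_eqOn (U₀ : GaugeField P 0 (SU N)) {j : ℕ} (hj : j ≤ P.m + P.K)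
    (hU₀ : SmallBelow (fun j => blockAvg (P := P) (j := j) expMeanLogSU) j U₀) {Y : Set (Site P 0)}
    (hY : ∀ i, i < j → ∀ s : Site P i, toFine i s ∈ Y ↔ toFine (i + 1) (blockOf s) ∈ Y)
    {Z Z' : PBond P 0 → Matrix (Fin N) (Fin N) ℂ} (hZZ' : ∀ b : PBond P 0, b ∈ bondsIn 0 Y → Z b = Z' b)
    {c : PBond P j} (hc : c ∈ bondsIn j Y) :
    fderiv ℂ (iterMh j : (PBond P 0 → Matrix (Fin N) (Fin N) ℂ) → PBond P j → Matrix (Fin N) (Fin N) ℂ) (coeField U₀) Z c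
      = fderiv ℂ (iterMh j : (PBond P 0 → Matrix (Fin N) (Fin N) ℂ) → PBond P j → Matrix (Fin N) (Fin N) ℂ) (coeField U₀) Z' c := by
  -- the component at `c`
  set F : (PBond P 0 → Matrix (Fin N) (Fin N) ℂ) → Matrix (Fin N) (Fin N) ℂ := fun V => iterMh j V c with hF
  have hdiff : DifferentiableAt ℂ (iterMh j : (PBond P 0 → Matrix (Fin N) (Fin N) ℂ) → PBond P j → Matrix (Fin N) (Fin N) ℂ) (coeField U₀) :=
    differentiableAt_iterMh j hU₀
  have hFd : DifferentiableAt ℂ F (coeField U₀) := (differentiableAt_pi.1 hdiff) c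
  have hcomp : ∀ W : PBond P 0 → Matrix (Fin N) (Fin N) ℂ,
      fderiv ℂ (iterMh j : (PBond P 0 → Matrix (Fin N) (Fin N) ℂ) → PBond P j → Matrix (Fin N) (Fin N) ℂ) (coeField U₀) W c = fderiv ℂ F (coeField U₀) W := by
    intro W
    rw [hF, fderiv_pi (fun c => (differentiableAt_pi.1 hdiff) c)]
    rfl
  rw [hcomp, hcomp, ← hFd.lineDeriv_eq_fderiv, ← hFd.lineDeriv_eq_fderiv]
  -- the two lines agree on the region, hence the averages at `c` agree for every `t`
  show deriv (fun t : ℂ => F (coeField U₀ + t • Z)) 0 = deriv (fun t : ℂ => F (coeField U₀ + t • Z')) 0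
  congr 1
  funext t
  simp only [hF]
  exact iterMh_apply_congr_of_eqOn_bondsIn j hj hY (fun b hb => by rw [Pi.add_apply, Pi.add_apply, Pi.smul_apply, Pi.smul_apply, hZZ' b hb]) c hc

/-- ★ **PRINT's LINEARISED AVERAGE `Q_j(U₀)Y (c)` READS A TRACELESS `Y` ONLY ON `bondsIn 0 Y`**: by F1 ✓`fderiv_iterMh_mul_star_eq_qCplxOp`, `L^j·(Q_j(U₀)Y)(c) =
D(Ū^j_h)(↑U₀)[Y·U₀](c)·Ū^j(U₀)(c)⋆`, and §2. [cite: Balaban1985BackgroundPropagators, (3.13)–(3.15) p.393; Balaban1985Averaging, p.24, (147) p.40] -/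
theorem qCplxOp_apply_congr_of_eqOn (U₀ : GaugeField P 0 (SU N)) {j : ℕ} (hj : j ≤ P.m + P.K)
    (hU₀ : SmallBelow (fun j => blockAvg (P := P) (j := j) expMeanLogSU) j U₀) {Y : Set (Site P 0)}
    (hY : ∀ i, i < j → ∀ s : Site P i, toFine i s ∈ Y ↔ toFine (i + 1) (blockOf s) ∈ Y)
    {Y₁ Y₂ : PBond P 0 → Matrix (Fin N) (Fin N) ℂ} (h₁ : ∀ b, (Y₁ b).trace = 0) (h₂ : ∀ b, (Y₂ b).trace = 0)
    (hYY : ∀ b : PBond P 0, b ∈ bondsIn 0 Y → Y₁ b = Y₂ b) {c : PBond P j} (hc : c ∈ bondsIn j Y) :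
    qCplxOp j U₀ Y₁ c = qCplxOp j U₀ Y₂ c := by
  have hL : ((P.L : ℂ) ^ j) ≠ 0 := pow_ne_zero _ (Nat.cast_ne_zero.2 P.L_pos.ne')
  have e₁ := fderiv_iterMh_mul_star_eq_qCplxOp U₀ hU₀ h₁ c
  have e₂ := fderiv_iterMh_mul_star_eq_qCplxOp U₀ hU₀ h₂ c
  have hZ : ∀ b : PBond P 0, b ∈ bondsIn 0 Y → Y₁ b * (U₀ b : Matrix (Fin N) (Fin N) ℂ) = Y₂ b * (U₀ b : Matrix (Fin N) (Fin N) ℂ) :=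
    fun b hb => by rw [hYY b hb]
  rw [fderiv_iterMh_apply_congr_of_eqOn U₀ hj hU₀ hY hZ hc] at e₁
  exact smul_right_injective _ hL (e₁.symm.trans e₂)

end Generic

/-! ## §3  At the record: `C_j^{𝔰𝔩}(A′)(c)` reads `ev(P A′)` only on the region -/

section Record

variable (F : T4Family) (N : ℕ) [NeZero N] {K : ℕ} (k : ℕ) (Ω : ℕ → Set (Site (F.P K) 0)) (U₀ : GaugeField (F.P K) 0 (SU N))
variable [Fact (0 < (F.L : ℝ))] [Fact (0 < (F.P K).eta k)]

/-- ★★ **`C_j^{𝔰𝔩}(A′)(c)` DEPENDS ON `A′` ONLY THROUGH `ev(P A′)` ON `bondsIn 0 Y`** (guard below `j`, `Y` saturated below `j`, `c ∈ bondsIn j Y`): both the log-coordinate of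
the holomorphic average (§1, chart `X = η_k·ev(P A′)`) and the linear part `(L^jη_k)·Q_j(U₀)ev(P A′)` (§2; `ev(P A′)` is traceless, ✓`trace_equiv_slProjLit`) are local.
[cite: Balaban1985Variational, (44) p.285, (51) p.286; Balaban1985Averaging, p.24] -/
theorem equiv_CslJOfRecord_apply_congr (j : ℕ) (hj : j ≤ (F.P K).m + (F.P K).K) (levB : PBond (F.P K) j → ℕ)
    (hU₀ : SmallBelow (avOfRecord F N K) j U₀) {Y : Set (Site (F.P K) 0)}
    (hY : ∀ i, i < j → ∀ s : Site (F.P K) i, toFine i s ∈ Y ↔ toFine (i + 1) (blockOf s) ∈ Y)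
    {A A' : Space115Lit F N K k Ω U₀}
    (hAA' : ∀ b : PBond (F.P K) 0, b ∈ bondsIn 0 Y → evLit F N K k Ω U₀ (slProjLit F N K k Ω U₀ A) b = evLit F N K k Ω U₀ (slProjLit F N K k Ω U₀ A') b)
    {c : PBond (F.P K) j} (hc : c ∈ bondsIn j Y) :
    NegSup.equiv _ _ (CslJOfRecord F N K k Ω U₀ j levB A) c = NegSup.equiv _ _ (CslJOfRecord F N K k Ω U₀ j levB A') c := by
  have htr : ∀ (B : Space115Lit F N K k Ω U₀) (b : PBond (F.P K) 0), (evLit F N K k Ω U₀ (slProjLit F N K k Ω U₀ B) b).trace = 0 := fun B b => by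
    rw [evLit_apply]; exact trace_equiv_slProjLit (F := F) (N := N) (K := K) (k := k) (Ω := Ω) (U₀ := U₀) B _
  have hX : ∀ b : PBond (F.P K) 0, b ∈ bondsIn 0 Y →
      ((((F.P K).eta k : ℝ) : ℂ) • evLit F N K k Ω U₀ (slProjLit F N K k Ω U₀ A)) b
        = ((((F.P K).eta k : ℝ) : ℂ) • evLit F N K k Ω U₀ (slProjLit F N K k Ω U₀ A')) b := fun b hb => by
    rw [Pi.smul_apply, Pi.smul_apply, hAA' b hb]
  rw [CslJOfRecord_apply, CslJOfRecord_apply, CjOfRecord_apply, CjOfRecord_apply,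
    iterMh_expOver_apply_congr U₀ hj hY hX hc,
    qCplxOp_apply_congr_of_eqOn U₀ hj hU₀ hY (htr A) (htr A') hAA' hc]

/-- ★★ The same for 3f′'s `C^{𝔰𝔩} = CslOfRecord` (the top member `j = k`, ✓`CslJOfRecord_top`). [cite: Balaban1985Variational, (44) p.285, (51) p.286; Balaban1985Averaging, p.24] -/
theorem equiv_CslOfRecord_apply_congr (hk : k ≤ (F.P K).m + (F.P K).K) (levB : PBond (F.P K) k → ℕ)
    (hU₀ : SmallBelow (avOfRecord F N K) k U₀) {Y : Set (Site (F.P K) 0)}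
    (hY : ∀ i, i < k → ∀ s : Site (F.P K) i, toFine i s ∈ Y ↔ toFine (i + 1) (blockOf s) ∈ Y)
    {A A' : Space115Lit F N K k Ω U₀}
    (hAA' : ∀ b : PBond (F.P K) 0, b ∈ bondsIn 0 Y → evLit F N K k Ω U₀ (slProjLit F N K k Ω U₀ A) b = evLit F N K k Ω U₀ (slProjLit F N K k Ω U₀ A') b)
    {c : PBond (F.P K) k} (hc : c ∈ bondsIn k Y) :
    NegSup.equiv _ _ (CslOfRecord F N K k Ω U₀ levB A) c = NegSup.equiv _ _ (CslOfRecord F N K k Ω U₀ levB A') c := by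
  rw [← CslJOfRecord_top]
  exact equiv_CslJOfRecord_apply_congr F N k Ω U₀ k hk levB hU₀ hY hAA' hc

/-! ## §4  The support of the derivative kernel `(D C_j^{𝔰𝔩}(A′)·δ_b X)(c)` -/

omit [NeZero N] in
/-- `ev(P(δ_b X))` vanishes at every record bond other than `b`'s. [cite: Balaban1985Variational, (90) p.291, (51) p.286 (bookkeeping)] -/
theorem evLit_slProjLit_single115_of_ne (X : Matrix (Fin N) (Fin N) ℂ) {bb : B9SectCLatticeCarrier.Bond (F.P K).d (fun _ => (F.P K).sitesPerDir 0)}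
    {b : PBond (F.P K) 0} (hb : b ≠ (bondToLit (F.P K) 0).symm bb) :
    evLit F N K k Ω U₀ (slProjLit F N K k Ω U₀ (single115 (lev₁ := pairLevLit F Ω k) (Dc := nabla115 ((F.P K).eta k) (unitsOfRecord F N U₀)) bb X)) b = 0 := by
  have hne : bondToLit (F.P K) 0 b ≠ bb := fun h => hb (by rw [← h, Equiv.symm_apply_apply])
  rw [evLit_slProjLit, evLit_apply]
  have h1 : JetSup.equiv _ _ _ (single115 (L := (F.L : ℝ)) (η := (F.P K).eta k) (lev₀ := bondLevLit F Ω k) (lev₁ := pairLevLit F Ω k)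
      (Dc := nabla115 ((F.P K).eta k) (unitsOfRecord F N U₀)) bb X) = Pi.single bb X :=
    B11Eq90Transpose.flat115_single115 (L := (F.L : ℝ)) (η := (F.P K).eta k) (lev₀ := bondLevLit F Ω k) (lev₁ := pairLevLit F Ω k)
      (Dc := nabla115 ((F.P K).eta k) (unitsOfRecord F N U₀)) bb X
  rw [h1, Pi.single_eq_of_ne hne, map_zero]

/-- ★★ **THE DERIVATIVE KERNEL OF `C_j^{𝔰𝔩}` IS SUPPORTED ON THE REGION**: if `b`'s record bond is NOT in `bondsIn 0 Y` (`Y` saturated below `j`, guard below `j`,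
`c ∈ bondsIn j Y`), then `(D C_j^{𝔰𝔩}(A′)·δ_b X)(c) = 0` at EVERY `A′` — for differentiable `A′` the entry is the line derivative of `t ↦ C_j^{𝔰𝔩}(A′ + tδ_b X)(c)`, constant by §3;
otherwise `fderiv = 0`.  The SUPPORT half of (KL-C): `gC(c, b) = 0` off the two-block cone of `c`. [cite: Balaban1985Averaging, p.24, Proposition 5 (157) p.42; Balaban1985Variational, (73) p.289] -/
theorem equiv_fderiv_CslJOfRecord_single_eq_zero (j : ℕ) (hj : j ≤ (F.P K).m + (F.P K).K) (levB : PBond (F.P K) j → ℕ)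
    (hU₀ : SmallBelow (avOfRecord F N K) j U₀) {Y : Set (Site (F.P K) 0)}
    (hY : ∀ i, i < j → ∀ s : Site (F.P K) i, toFine i s ∈ Y ↔ toFine (i + 1) (blockOf s) ∈ Y)
    {c : PBond (F.P K) j} (hc : c ∈ bondsIn j Y) {bb : B9SectCLatticeCarrier.Bond (F.P K).d (fun _ => (F.P K).sitesPerDir 0)}
    (hbb : (bondToLit (F.P K) 0).symm bb ∉ bondsIn 0 Y) (A : Space115Lit F N K k Ω U₀) (X : Matrix (Fin N) (Fin N) ℂ) :
    NegSup.equiv _ _ (fderiv ℂ (CslJOfRecord F N K k Ω U₀ j levB) A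
      (single115 (lev₁ := pairLevLit F Ω k) (Dc := nabla115 ((F.P K).eta k) (unitsOfRecord F N U₀)) bb X)) c = 0 := by
  set δ : Space115Lit F N K k Ω U₀ := single115 (lev₁ := pairLevLit F Ω k) (Dc := nabla115 ((F.P K).eta k) (unitsOfRecord F N U₀)) bb X with hδ
  by_cases hd : DifferentiableAt ℂ (CslJOfRecord F N K k Ω U₀ j levB) A
  · -- read the entry at `c` through the evaluation functional
    set E := NegSup.evalCLM ℂ (V := Matrix (Fin N) (Fin N) ℂ) (levWeight (F.L : ℝ) ((F.P K).eta k) levB 0) c with hE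
    have hcomp : fderiv ℂ (fun B => E (CslJOfRecord F N K k Ω U₀ j levB B)) A = E.comp (fderiv ℂ (CslJOfRecord F N K k Ω U₀ j levB) A) :=
      (E.hasFDerivAt.comp A hd.hasFDerivAt).fderiv
    have hread : NegSup.equiv _ _ (fderiv ℂ (CslJOfRecord F N K k Ω U₀ j levB) A δ) c = fderiv ℂ (fun B => E (CslJOfRecord F N K k Ω U₀ j levB B)) A δ := by
      rw [hcomp]; rfl
    rw [hread]
    have hgd : DifferentiableAt ℂ (fun B => E (CslJOfRecord F N K k Ω U₀ j levB B)) A := E.differentiableAt.comp A hd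
    rw [← hgd.lineDeriv_eq_fderiv]
    -- the line `t ↦ C_j^{sl}(A + tδ)(c)` is constant
    have hconst : (fun t : ℂ => E (CslJOfRecord F N K k Ω U₀ j levB (A + t • δ))) = fun _ => E (CslJOfRecord F N K k Ω U₀ j levB A) := by
      funext t
      show NegSup.equiv _ _ (CslJOfRecord F N K k Ω U₀ j levB (A + t • δ)) c = NegSup.equiv _ _ (CslJOfRecord F N K k Ω U₀ j levB A) c
      refine equiv_CslJOfRecord_apply_congr F N k Ω U₀ j hj levB hU₀ hY (fun b hb => ?_) hc
      have hne : b ≠ (bondToLit (F.P K) 0).symm bb := fun h => hbb (h ▸ hb)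
      rw [map_add, map_smul, map_add, map_smul, Pi.add_apply, Pi.smul_apply, hδ, evLit_slProjLit_single115_of_ne F N k Ω U₀ X hne, smul_zero, add_zero]
    show deriv (fun t : ℂ => E (CslJOfRecord F N K k Ω U₀ j levB (A + t • δ))) 0 = 0
    rw [hconst, deriv_const]
  · rw [fderiv_zero_of_not_differentiableAt hd]; rfl

/-- ★★ The same for `C^{𝔰𝔩} = CslOfRecord` (`j = k`): `(D C^{𝔰𝔩}(A′)·δ_b X)(c) = 0` whenever `b`'s record bond is not in `bondsIn 0 Y`, `c ∈ bondsIn k Y` — the support half of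
(KL-C) for the letter of ✓`prop4LetterColumnsAtRecord_of_kernelLetters`. [cite: Balaban1985Averaging, p.24, Proposition 5 (157) p.42; Balaban1985Variational, (73) p.289] -/
theorem equiv_fderiv_CslOfRecord_single_eq_zero (hk : k ≤ (F.P K).m + (F.P K).K) (levB : PBond (F.P K) k → ℕ)
    (hU₀ : SmallBelow (avOfRecord F N K) k U₀) {Y : Set (Site (F.P K) 0)}
    (hY : ∀ i, i < k → ∀ s : Site (F.P K) i, toFine i s ∈ Y ↔ toFine (i + 1) (blockOf s) ∈ Y)
    {c : PBond (F.P K) k} (hc : c ∈ bondsIn k Y) {bb : B9SectCLatticeCarrier.Bond (F.P K).d (fun _ => (F.P K).sitesPerDir 0)}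
    (hbb : (bondToLit (F.P K) 0).symm bb ∉ bondsIn 0 Y) (A : Space115Lit F N K k Ω U₀) (X : Matrix (Fin N) (Fin N) ℂ) :
    NegSup.equiv _ _ (fderiv ℂ (CslOfRecord F N K k Ω U₀ levB) A
      (single115 (lev₁ := pairLevLit F Ω k) (Dc := nabla115 ((F.P K).eta k) (unitsOfRecord F N U₀)) bb X)) c = 0 := by
  rw [← CslJOfRecord_top]
  exact equiv_fderiv_CslJOfRecord_single_eq_zero F N k Ω U₀ k hk levB hU₀ hY hc hbb A X

end Record

end Summit.QuantumFields.YangMills.Theorems.C44IterMh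

end
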